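import Literature.Combinatorics.SetFamily.OddtownTheorem

/-!
# The Ahlswede–El Gamal–Pang theorem: two families with all cross intersections even satisfy
# `|𝓐|·|𝓑| ≤ 2ⁿ`

S. Jukna, *Extremal Combinatorics — with applications in computer science* (1st ed., Springer 2001)
[Jukna2001], Chapter 15 "Orthogonality and rank arguments", §15.1.1 "Orthogonal coding":
Theorem 15.1 (Ahlswede–El Gamal–Pang 1984) with the proof of Delsarte–Piret (1985) printed there,
and Exercise 15.1 (the "odd" case with the printed hint); originals:
R. Ahlswede, A. El Gamal, K. F. Pang, *A two-family extremal problem in Hamming space*, Discrete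
Math. 49 (1984) 1–5 [AhlswedeElGamalPang1984]; Ph. Delsarte, Ph. Piret, *An extension of an
inequality by Ahlswede, El Gamal and Pang for pairs of binary codes*, Discrete Math. 55 (1985)
313–315 [DelsartePiret1985].

**Theorem 15.1.** Let `𝓐` and `𝓑` be two families of subsets of an `n`-element set with `|A ∩ B|`
even for all `A ∈ 𝓐`, `B ∈ 𝓑`. Then `|𝓐|·|𝓑| ≤ 2ⁿ`. The same holds with "even" replaced by
"odd"; then even `|𝓐|·|𝓑| ≤ 2ⁿ⁻¹` (Exercise 15.1).

Printed proof: incidence vectors in `𝔽₂ⁿ`; `U` = vectors of `𝓐`, `V` = vectors of `𝓑`, `v₀ ∈ V`,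
`V₀ = v₀ + V`; every `u ∈ U` is orthogonal to every `w ∈ V₀` (all `⟨u, v⟩` have the same parity),
so `dim U' ≤ n − dim V₀'` for the spans, and `|𝓐|·|𝓑| = |U|·|V₀| ≤ |U'|·|V₀'| ≤ 2^{dim U' + dim V₀'}
≤ 2ⁿ`.  For the odd case (hint of Exercise 15.1) replace `U` by `U ∪ (u₀ + U)`, a disjoint union.

PROVED here (theorems only, no named facts), over `𝔽₂ = ZMod 2` with the incidence vectors and
`⟨v_A, v_B⟩ = |A ∩ B|` of `OddtownTheorem.lean`:
* `dotProduct_eq_zero_of_mem_span` — orthogonality passes to spans;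
* `finrank_add_finrank_le_of_dotProduct_eq_zero` — Proposition 14.2 in the form used: mutually
  orthogonal subspaces `U, W ≤ Fⁿ` have `dim U + dim W ≤ n` (any field; rank–nullity for the
  matrix whose rows are a basis of `W`);
* `card_mul_card_le_two_pow_of_dotProduct_eq_zero` — the engine (15.1): `|S|·|T| ≤ 2ⁿ` for
  mutually orthogonal `S, T ⊆ 𝔽₂ⁿ`;
* **`card_mul_card_le_two_pow_of_card_inter_even`** — Theorem 15.1;
  **`card_mul_card_le_two_pow_of_card_inter_parity`** — the same-parity form the printed proof
  gives; **`card_mul_card_le_two_pow_pred_of_card_inter_odd`** — Exercise 15.1 (`≤ 2ⁿ⁻¹`).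

## References

* [Jukna2001] S. Jukna, *Extremal Combinatorics*, 1st ed., Springer (2001), Theorem 15.1 and its
  proof, Exercise 15.1 (held text
  `book:jukna2011-extremal-combinatorics-with-applications-computer-science`, chunks 191, 201–202).
* [AhlswedeElGamalPang1984] R. Ahlswede, A. El Gamal, K. F. Pang, Discrete Math. 49 (1984) 1–5,
  doi:10.1016/0012-365X(84)90144-4.
* [DelsartePiret1985] Ph. Delsarte, Ph. Piret, Discrete Math. 55 (1985) 313–315,
  doi:10.1016/S0012-365X(85)80008-X.
-/

namespace Literature.Combinatorics.SetFamily

open Finset Matrix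

/-! ### Orthogonal subspaces of `Fⁿ` -/

section Field

variable {F : Type*} [Field F] {ι : Type*} [Fintype ι]

/-- Orthogonality of generators passes to the spans (bilinearity of the dot product).
[cite: Jukna2001, Ch. 15 §15.1.1, proof of Theorem 15.1 ("let `U'` and `V₀'` be the subspaces
spanned by `U` and `V₀`")] -/
theorem dotProduct_eq_zero_of_mem_span {S T : Set (ι → F)} (h : ∀ s ∈ S, ∀ t ∈ T, s ⬝ᵥ t = 0)
    {u w : ι → F} (hu : u ∈ Submodule.span F S) (hw : w ∈ Submodule.span F T) : u ⬝ᵥ w = 0 := by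
  -- first for a generator `t`, by induction on `u`; then by induction on `w`
  have step : ∀ t ∈ T, ∀ u ∈ Submodule.span F S, u ⬝ᵥ t = 0 := by
    intro t ht u hu
    induction hu using Submodule.span_induction with
    | mem x hx => exact h x hx t ht
    | zero => exact zero_dotProduct _
    | add x y _ _ hx hy => rw [add_dotProduct, hx, hy, add_zero]
    | smul c x _ hx => rw [smul_dotProduct, hx, smul_zero]
  induction hw using Submodule.span_induction with
  | mem x hx => exact step x hx u hu
  | zero => exact dotProduct_zero _
  | add x y _ _ hx hy => rw [dotProduct_add, hx, hy, add_zero]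
  | smul c x _ hx => rw [dotProduct_smul, hx, smul_zero]

/-- **Proposition 14.2, as used: mutually orthogonal subspaces `U, W ≤ Fⁿ` have
`dim U + dim W ≤ n`** (`U ≤ W^⊥` and `dim W^⊥ = n − dim W`: rank–nullity for the matrix whose rows
form a basis of `W`). [cite: Jukna2001, Ch. 14 Proposition 14.2 and Ch. 15 proof of
Theorem 15.1 ("`dim U' ≤ n − dim V₀'`")] -/
theorem finrank_add_finrank_le_of_dotProduct_eq_zero (U W : Submodule F (ι → F))
    (h : ∀ u ∈ U, ∀ w ∈ W, u ⬝ᵥ w = 0) :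
    Module.finrank F U + Module.finrank F W ≤ Fintype.card ι := by
  classical
  set d := Module.finrank F W with hd
  let b := Module.finBasis F W
  let G : Matrix (Fin d) ι F := Matrix.of fun i a => (b i : ι → F) a
  -- `U ≤ ker G`
  have hUker : U ≤ LinearMap.ker G.mulVecLin := by
    intro u hu
    rw [LinearMap.mem_ker, Matrix.mulVecLin_apply]
    funext i
    change (fun a => (b i : ι → F) a) ⬝ᵥ u = 0
    rw [dotProduct_comm]
    exact h u hu _ (b i).2
  -- `rank G = d`
  have hrange : Module.finrank F (LinearMap.range G.mulVecLin) = d := by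
    change G.rank = d
    rw [Matrix.rank_eq_finrank_span_row]
    have hli : LinearIndependent F (fun i => (b i : ι → F)) :=
      b.linearIndependent.map' W.subtype W.ker_subtype
    have h1 := finrank_span_eq_card hli
    rw [Fintype.card_fin] at h1
    exact h1
  have hrn := LinearMap.finrank_range_add_finrank_ker G.mulVecLin
  rw [Module.finrank_fintype_fun_eq_card, hrange] at hrn
  have hker := Submodule.finrank_mono hUker
  omega

end Field

/-! ### The engine: mutually orthogonal subsets of `𝔽₂ⁿ` -/

variable {α : Type*} [DecidableEq α] [Fintype α]

omit [DecidableEq α] in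
/-- **(15.1): mutually orthogonal sets `S, T ⊆ 𝔽₂ⁿ` satisfy `|S|·|T| ≤ 2ⁿ`** —
`|S|·|T| ≤ |span S|·|span T| = 2^{dim + dim} ≤ 2ⁿ`. [cite: Jukna2001, Ch. 15 §15.1.1, proof of
Theorem 15.1, display (15.1); DelsartePiret1985] -/
theorem card_mul_card_le_two_pow_of_dotProduct_eq_zero (S T : Finset (α → ZMod 2))
    (h : ∀ s ∈ S, ∀ t ∈ T, s ⬝ᵥ t = 0) : S.card * T.card ≤ 2 ^ Fintype.card α := by
  classical
  set U := Submodule.span (ZMod 2) (S : Set (α → ZMod 2)) with hU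
  set W := Submodule.span (ZMod 2) (T : Set (α → ZMod 2)) with hW
  have horth : ∀ u ∈ U, ∀ w ∈ W, u ⬝ᵥ w = 0 := fun u hu w hw =>
    dotProduct_eq_zero_of_mem_span (fun s hs t ht => h s hs t ht) hu hw
  have hdim := finrank_add_finrank_le_of_dotProduct_eq_zero U W horth
  have hS : S.card ≤ Nat.card U := by
    have hinj : Function.Injective (fun s : S => (⟨s.1, Submodule.subset_span s.2⟩ : U)) := by
      intro x y hxy
      exact Subtype.ext (congrArg (fun u : U => (u : α → ZMod 2)) hxy)
    have := Nat.card_le_card_of_injective _ hinj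
    rwa [Nat.card_eq_fintype_card, Fintype.card_coe] at this
  have hT : T.card ≤ Nat.card W := by
    have hinj : Function.Injective (fun t : T => (⟨t.1, Submodule.subset_span t.2⟩ : W)) := by
      intro x y hxy
      exact Subtype.ext (congrArg (fun w : W => (w : α → ZMod 2)) hxy)
    have := Nat.card_le_card_of_injective _ hinj
    rwa [Nat.card_eq_fintype_card, Fintype.card_coe] at this
  rw [Module.natCard_eq_pow_finrank (K := ZMod 2), Nat.card_zmod] at hS hT
  calc S.card * T.card
      ≤ 2 ^ Module.finrank (ZMod 2) U * 2 ^ Module.finrank (ZMod 2) W := Nat.mul_le_mul hS hT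
    _ = 2 ^ (Module.finrank (ZMod 2) U + Module.finrank (ZMod 2) W) := (pow_add _ _ _).symm
    _ ≤ 2 ^ Fintype.card α := Nat.pow_le_pow_right (by norm_num) hdim

/-! ### Theorem 15.1 and Exercise 15.1 -/

/-- **Theorem 15.1, same-parity form (the printed proof).** If all the intersections `A ∩ B`,
`A ∈ 𝓐`, `B ∈ 𝓑`, have the same parity, then `|𝓐|·|𝓑| ≤ 2ⁿ` (translate the vectors of `𝓑` by a
fixed `v₀`: `⟨u, v₀ + v⟩ = ⟨u, v₀⟩ + ⟨u, v⟩ = 0`). [cite: Jukna2001, Ch. 15 §15.1.1, Theorem 15.1 and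
its proof; AhlswedeElGamalPang1984; DelsartePiret1985] -/
theorem card_mul_card_le_two_pow_of_card_inter_parity (𝓐 𝓑 : Finset (Finset α))
    (h : ∀ A ∈ 𝓐, ∀ B ∈ 𝓑, ∀ B' ∈ 𝓑, (((A ∩ B).card : ZMod 2)) = (A ∩ B').card) :
    𝓐.card * 𝓑.card ≤ 2 ^ Fintype.card α := by
  classical
  rcases 𝓑.eq_empty_or_nonempty with hB | ⟨B₀, hB₀⟩
  · simp [hB]
  set v : Finset α → (α → ZMod 2) := fun A a => if a ∈ A then 1 else 0 with hv
  have hvinj : Function.Injective v := by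
    intro A B hAB
    ext a
    have ha := congrFun hAB a
    simp only [hv] at ha
    by_cases hA : a ∈ A <;> by_cases hB : a ∈ B <;> simp_all
  -- `S = U`, `T = V₀ = v₀ + V`
  have hle := card_mul_card_le_two_pow_of_dotProduct_eq_zero (𝓐.image v)
    (𝓑.image fun B => v B₀ + v B) (by
      intro s hs t ht
      obtain ⟨A, hA, rfl⟩ := Finset.mem_image.mp hs
      obtain ⟨B, hB, rfl⟩ := Finset.mem_image.mp ht
      rw [dotProduct_add, hv, indicator_dotProduct_indicator, indicator_dotProduct_indicator,
        h A hA B₀ hB₀ B hB, ← two_mul, show (2 : ZMod 2) = 0 from rfl, zero_mul])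
  rwa [Finset.card_image_of_injective _ hvinj,
    Finset.card_image_of_injective _ (fun B B' hBB' => hvinj (add_left_cancel hBB'))] at hle

/-- **Theorem 15.1 (Ahlswede–El Gamal–Pang 1984).** Let `𝓐` and `𝓑` be families of subsets of an
`n`-element set with `|A ∩ B|` even for all `A ∈ 𝓐`, `B ∈ 𝓑`. Then `|𝓐|·|𝓑| ≤ 2ⁿ`.
[cite: Jukna2001, Ch. 15 §15.1.1, Theorem 15.1; AhlswedeElGamalPang1984] -/
theorem card_mul_card_le_two_pow_of_card_inter_even (𝓐 𝓑 : Finset (Finset α))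
    (h : ∀ A ∈ 𝓐, ∀ B ∈ 𝓑, Even (A ∩ B).card) : 𝓐.card * 𝓑.card ≤ 2 ^ Fintype.card α := by
  refine card_mul_card_le_two_pow_of_card_inter_parity 𝓐 𝓑 fun A hA B hB B' hB' => ?_
  rw [ZMod.natCast_eq_zero_iff_even.mpr (h A hA B hB), ZMod.natCast_eq_zero_iff_even.mpr (h A hA B' hB')]

/-- **Exercise 15.1 (the odd case).** If `|A ∩ B|` is odd for all `A ∈ 𝓐`, `B ∈ 𝓑`, then
`|𝓐|·|𝓑| ≤ 2ⁿ⁻¹`: with `u₀ ∈ U` the set `U ∪ (u₀ + U)` is a disjoint union (a vector `u₀ + u = u'`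
would have `⟨u', v⟩ = 1 + 1 = 0`), still orthogonal to `V₀`, so `2|𝓐|·|𝓑| ≤ 2ⁿ`.
[cite: Jukna2001, Ch. 15 Exercise 15.1 (hint); AhlswedeElGamalPang1984] -/
theorem card_mul_card_le_two_pow_pred_of_card_inter_odd (𝓐 𝓑 : Finset (Finset α))
    (h : ∀ A ∈ 𝓐, ∀ B ∈ 𝓑, Odd (A ∩ B).card) :
    𝓐.card * 𝓑.card ≤ 2 ^ (Fintype.card α - 1) := by
  classical
  rcases 𝓑.eq_empty_or_nonempty with hB | ⟨B₀, hB₀⟩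
  · simp [hB]
  rcases 𝓐.eq_empty_or_nonempty with hA | ⟨A₀, hA₀⟩
  · simp [hA]
  -- `n ≥ 1`: `A₀ ∩ B₀` is nonempty
  have hn : 1 ≤ Fintype.card α := by
    have hodd := h A₀ hA₀ B₀ hB₀
    have hpos : 0 < (A₀ ∩ B₀).card := Nat.pos_of_ne_zero fun h0 => by
      rw [h0] at hodd; exact (Nat.not_odd_zero hodd).elim
    exact hpos.trans_le ((Finset.card_le_univ _).trans le_rfl)
  set v : Finset α → (α → ZMod 2) := fun A a => if a ∈ A then 1 else 0 with hv
  have hvinj : Function.Injective v := by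
    intro A B hAB
    ext a
    have ha := congrFun hAB a
    simp only [hv] at ha
    by_cases hA : a ∈ A <;> by_cases hB : a ∈ B <;> simp_all
  have hvv : ∀ A ∈ 𝓐, ∀ B ∈ 𝓑, v A ⬝ᵥ v B = 1 := by
    intro A hA B hB
    rw [hv, indicator_dotProduct_indicator]
    exact ZMod.natCast_eq_one_iff_odd.mpr (h A hA B hB)
  -- `S = U ∪ (u₀ + U)`, `T = v₀ + V`
  have hdisj : Disjoint (𝓐.image v) (𝓐.image fun A => v A₀ + v A) := by
    rw [Finset.disjoint_left]
    intro s hs hs'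
    obtain ⟨A, hA, rfl⟩ := Finset.mem_image.mp hs
    obtain ⟨A', hA', hAA'⟩ := Finset.mem_image.mp hs'
    have h1 := hvv A hA B₀ hB₀
    rw [← hAA', add_dotProduct, hvv A₀ hA₀ B₀ hB₀, hvv A' hA' B₀ hB₀] at h1
    exact absurd h1 (by decide)
  have hle := card_mul_card_le_two_pow_of_dotProduct_eq_zero
    (𝓐.image v ∪ 𝓐.image fun A => v A₀ + v A) (𝓑.image fun B => v B₀ + v B) (by
      intro s hs t ht
      obtain ⟨B, hB, rfl⟩ := Finset.mem_image.mp ht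
      rcases Finset.mem_union.mp hs with hs | hs
      · obtain ⟨A, hA, rfl⟩ := Finset.mem_image.mp hs
        rw [dotProduct_add, hvv A hA B₀ hB₀, hvv A hA B hB]
        decide
      · obtain ⟨A, hA, rfl⟩ := Finset.mem_image.mp hs
        rw [dotProduct_add, add_dotProduct, add_dotProduct, hvv A₀ hA₀ B₀ hB₀, hvv A hA B₀ hB₀,
          hvv A₀ hA₀ B hB, hvv A hA B hB]
        decide)
  rw [Finset.card_union_of_disjoint hdisj, Finset.card_image_of_injective _ hvinj,
    Finset.card_image_of_injective _ (fun A A' hAA' => hvinj (add_left_cancel hAA')),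
    Finset.card_image_of_injective _ (fun B B' hBB' => hvinj (add_left_cancel hBB'))] at hle
  -- `2|𝓐|·|𝓑| ≤ 2ⁿ`
  obtain ⟨m, hm⟩ : ∃ m, Fintype.card α = m + 1 := ⟨Fintype.card α - 1, by omega⟩
  rw [hm, pow_succ] at hle
  rw [hm, Nat.add_sub_cancel]
  nlinarith [hle]

end Literature.Combinatorics.SetFamily
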